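import Mathlib
import HarnessLib
import Summits.NavierStokesRegularity.NavierStokesRegularity.Theorems.PoloidalWindowDoorLrcModEntireThreadPins
import Summits.NavierStokesRegularity.NavierStokesRegularity.Theorems.PoloidalWindowDoorLrcModEntireRidgeClassConstants

/-!
# Item `LrcModEntire` (stmt-NavierStokesRegularity-20428) — the DEGENERATE (flat) hot point: a flat normal direction is a NULL direction of the whole Hessian
# (memo `Cruxes/LrcModEntire/T2B-g14.md` §13c «κ = 0 ⇒ α = 0»: at a flat hot point the twist coefficient vanishes)

ns-k2-port-2 g6 (helper prover under the LEAD of item 20428, ns-poloidal-K2-p3 g15; `--supports stmt-NavierStokesRegularity-20428 --as helper`).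
The (TH) column's surviving sub-cell besides (Q4) is the DEGENERATE hot point (`σΔₕv₂(−1,y) = 0`; T2B-g14 §13c / LEAD g15 11:16Z «open: the degenerate hot point»).  Its entry
structure is elementary: a hot point is a global maximum of `σv₂(−1,·)` (hot-spot normalisation), so the Hessian there is negative semi-definite, and for a negative
semi-definite symmetric form a direction `ν` with `B(ν,ν) = 0` is `B`-orthogonal to everything (Cauchy–Schwarz).  Hence at a flat hot point (`D²v₂(y)[ν,ν] = 0` for the ridge
normal `ν`) the whole row `D²v₂(y)[ν,·]` vanishes — in particular the twist `α = D²v₂(y)[ν,e₂] = 0` and (with the tangential row zero on a critical curve) the second jet of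
`v₂(−1,·) − N` at `y` reduces to the single entry `β = ∂_z²v₂(y)` (`= −μ₀Δₕv₂ = 0` on a (TH) plane, `…plane_wave_identity`).

* `apply_eq_zero_of_nonpos_of_apply_self_eq_zero` — symmetric `B` with `B(w,w) ≤ 0` for all `w` and `B(ν,ν) = 0` ⇒ `B(ν,w) = 0` for all `w`;
* `hessian_nonpos_of_isMaxOn`, `hessian_row_eq_zero_of_isMaxOn` — for `f ∈ C²` with a global maximum at `y`: `D²f(y)[w,w] ≤ 0`, and `D²f(y)[ν,ν] = 0 ⇒ D²f(y)[ν,·] = 0`;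
* `hessian_row_eq_zero_of_flat_hotPoint` — CLASS LEVEL: pinned class profile (rate, continuity, Oseen-mild, hot-spot normalisation, `N ≠ 0`), hot point `y` (`v₂(−1,y) = N`),
  `D²(v₂(−1,·))(y)[ν,ν] = 0` ⇒ `D²(v₂(−1,·))(y)[ν,w] = 0` for every `w`.

WHAT THIS IS NOT: not a claim about Navier–Stokes regularity — the first structural fact of the open degenerate sub-cell of `stub_T2b` (bears_on LADDER-NS N0, item 20428 / crux 19708;
20428/19708/27893 OPEN).  No summit statement is proved here.
-/

noncomputable section

-- the summit and its single sub-problem share the name (CONVENTIONS §1), as in every Theorems file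
set_option linter.dupNamespace false

namespace Summit.NavierStokesRegularity.NavierStokesRegularity.Theorems.PoloidalWindowDoorLrcModEntireRidgeFlatHotPoint

open Set Filter Topology Metric Function
open scoped ContDiff
open Literature.Analysis Literature.Analysis.FluidPDE
open Summit.NavierStokesRegularity.NavierStokesRegularity.Theorems.LocalSineTubeDoorProfileAlignedWindowRigidityAncient
open Summit.NavierStokesRegularity.NavierStokesRegularity.Theorems.PoloidalWindowDoorLrcModEntireThreadPins
open Summit.NavierStokesRegularity.NavierStokesRegularity.Theorems.PoloidalWindowDoorLrcModEntireRidgeClassConstants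

/-! ### Linear algebra: a null vector of a semi-definite symmetric form is in its kernel -/

/-- **Cauchy–Schwarz for a negative semi-definite symmetric form**: `B(w,w) ≤ 0` for all `w`, `B` symmetric, `B(ν,ν) = 0` ⇒ `B(ν,w) = 0` for all `w`. [folklore] -/
theorem apply_eq_zero_of_nonpos_of_apply_self_eq_zero {E : Type*} [NormedAddCommGroup E] [NormedSpace ℝ E] (B : E →L[ℝ] E →L[ℝ] ℝ)
    (hsymm : ∀ u w, B u w = B w u) (hnonpos : ∀ w, B w w ≤ 0) {ν : E} (hν : B ν ν = 0) (w : E) : B ν w = 0 := by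
  set b : ℝ := B ν w with hb
  set c : ℝ := B w w with hc
  have hc0 : c ≤ 0 := hnonpos w
  set l : ℝ := b / (1 + |c|) with hl
  have hpos : 0 < 1 + |c| := by positivity
  have hq := hnonpos (ν + l • w)
  have hexp : B (ν + l • w) (ν + l • w) = 2 * l * b + l ^ 2 * c := by
    simp only [map_add, map_smul, add_apply, smul_apply, smul_eq_mul]
    rw [hν, hsymm w ν, ← hb, ← hc]; ring
  rw [hexp, hl] at hq
  -- `2 b²/(1+|c|) + b² c/(1+|c|)² ≤ 0` forces `b = 0`
  have hkey : b ^ 2 * (2 * (1 + |c|) + c) ≤ 0 := by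
    have e : 2 * (b / (1 + |c|)) * b + (b / (1 + |c|)) ^ 2 * c = b ^ 2 * (2 * (1 + |c|) + c) / (1 + |c|) ^ 2 := by
      field_simp
    rw [e] at hq
    exact (div_nonpos_iff.1 hq).elim (fun h => h.1.trans_eq' rfl |> fun _ => by nlinarith [h.1, h.2, pow_pos hpos 2]) fun h => by
      nlinarith [h.1, h.2, pow_pos hpos 2]
  have h2 : 0 < 2 * (1 + |c|) + c := by
    have : -|c| ≤ c := neg_abs_le c
    linarith [abs_nonneg c]
  have hb2 : b ^ 2 ≤ 0 := by
    by_contra h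
    push Not at h
    have := mul_pos h h2
    linarith
  exact pow_eq_zero_iff (n := 2) (by norm_num) |>.1 (le_antisymm hb2 (sq_nonneg b))

/-! ### The Hessian at a global maximum -/

variable {f : EuclideanSpace ℝ (Fin 3) → ℝ}

/-- At a global maximum of a `C²` function the Hessian is negative semi-definite (second-derivative test along lines). [folklore] -/
theorem hessian_nonpos_of_isMaxOn (hf : ContDiff ℝ 2 f) {y : EuclideanSpace ℝ (Fin 3)} (hmax : IsMaxOn f univ y) (w : EuclideanSpace ℝ (Fin 3)) :
    fderiv ℝ (fderiv ℝ f) y w w ≤ 0 := by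
  have hφc : ContDiff ℝ 2 (fun t : ℝ => f (y + t • w)) := hf.comp (contDiff_const.add (contDiff_id.smul contDiff_const))
  have hloc : IsLocalMax (fun t : ℝ => f (y + t • w)) 0 := by
    refine Filter.Eventually.of_forall fun t => ?_
    have h := hmax (mem_univ (y + t • w))
    simpa using h
  have h := deriv2_nonpos_of_isLocalMax hφc hloc
  rw [deriv2_line_eq_iteratedFDeriv hf y w, iteratedFDeriv_two_apply] at h
  simpa using h

/-- **At a global maximum, a flat direction is a null direction of the Hessian**: `f ∈ C²`, `IsMaxOn f univ y`, `D²f(y)[ν,ν] = 0` ⇒ `D²f(y)[ν,w] = 0` for all `w`. -/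
theorem hessian_row_eq_zero_of_isMaxOn (hf : ContDiff ℝ 2 f) {y : EuclideanSpace ℝ (Fin 3)} (hmax : IsMaxOn f univ y) {ν : EuclideanSpace ℝ (Fin 3)}
    (hν : fderiv ℝ (fderiv ℝ f) y ν ν = 0) (w : EuclideanSpace ℝ (Fin 3)) : fderiv ℝ (fderiv ℝ f) y ν w = 0 := by
  have hs : IsSymmSndFDerivAt ℝ f y := (hf.contDiffAt (x := y)).isSymmSndFDerivAt (by simp only [minSmoothness_of_isRCLikeNormedField]; norm_num)
  exact apply_eq_zero_of_nonpos_of_apply_self_eq_zero (fderiv ℝ (fderiv ℝ f) y) (fun u w => hs u w) (hessian_nonpos_of_isMaxOn hf hmax) hν w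

/-! ### Class level: the flat hot point -/

variable {C : ℝ} {v : ℝ → EuclideanSpace ℝ (Fin 3) → EuclideanSpace ℝ (Fin 3)}

/-- **AT A FLAT HOT POINT THE NORMAL IS A NULL DIRECTION OF THE WHOLE HESSIAN OF `v₂(−1,·)`.**  Pinned class profile (rate, continuity, Oseen-mild, divergence-free slices,
hot-spot normalisation `√(−t)|v₂| ≤ |N|`, `N = v₂(−1,0) ≠ 0`), a hot point `y` (`v₂(−1,y) = N`) and a direction `ν` with `D²(v₂(−1,·))(y)[ν,ν] = 0` ⇒
`D²(v₂(−1,·))(y)[ν,w] = 0` for every `w` — in particular the twist `D²v₂(y)[ν, e₂]` vanishes (T2B-g14 §13c). -/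
theorem hessian_row_eq_zero_of_flat_hotPoint (hrate : HasTypeITimeDecay C v) (hcont : ContinuousOn (uncurry v) (Iio (0 : ℝ) ×ˢ univ))
    (hmild : ∀ s t : ℝ, s < t → t < 0 → ∀ x, v t x = UnboundedOperators.heatExtension (v s) (t - s) x - oseenDuhamel 1 s v v t x)
    (hdiv : ∀ t < 0, VectorCalculus.IsDivFree (v t))
    (hne : v (-1) 0 2 ≠ 0) (hhot : ∀ t < 0, ∀ x, Real.sqrt (-t) * |v t x 2| ≤ |v (-1) 0 2|)
    {y : EuclideanSpace ℝ (Fin 3)} (hy : v (-1) y 2 = v (-1) 0 2) {ν : EuclideanSpace ℝ (Fin 3)}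
    (hν : fderiv ℝ (fderiv ℝ (fun x => v (-1) x 2)) y ν ν = 0) (w : EuclideanSpace ℝ (Fin 3)) :
    fderiv ℝ (fderiv ℝ (fun x => v (-1) x 2)) y ν w = 0 := by
  have hneg : (-1 : ℝ) < 0 := by norm_num
  -- the sign `σ` with `σN = |N|`, and the signed slice `g = σ·v₂(−1,·)` with a global maximum at `y`
  obtain ⟨σ, hσ, hσa⟩ : ∃ σ : ℝ, (σ = 1 ∨ σ = -1) ∧ σ * v (-1) 0 2 = |v (-1) 0 2| := by
    rcases lt_or_gt_of_ne hne with h | h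
    · exact ⟨-1, Or.inr rfl, by rw [abs_of_neg h]; ring⟩
    · exact ⟨1, Or.inl rfl, by rw [abs_of_pos h]; ring⟩
  have hσ1 : |σ| = 1 := by rcases hσ with h | h <;> simp [h]
  set g : EuclideanSpace ℝ (Fin 3) → ℝ := fun x => σ * v (-1) x 2 with hg
  have hg2 : ContDiff ℝ 2 g := contDiff_signed_slice hrate hcont hmild hdiv hneg σ
  have hmax : IsMaxOn g univ y := by
    intro x _
    have hx := hhot (-1) hneg x
    rw [neg_neg, Real.sqrt_one, one_mul] at hx
    show σ * v (-1) x 2 ≤ σ * v (-1) y 2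
    calc σ * v (-1) x 2 ≤ |σ * v (-1) x 2| := le_abs_self _
      _ = |v (-1) x 2| := by rw [abs_mul, hσ1, one_mul]
      _ ≤ |v (-1) 0 2| := hx
      _ = σ * v (-1) y 2 := by rw [hy, hσa]
  -- `D²g = σ·D²(v₂(−1,·))`
  have hslice : ContDiff ℝ 2 (v (-1)) := contDiff_slice_of_class hrate hcont hmild hdiv hneg
  have hθ2 : ContDiff ℝ 2 (fun x => v (-1) x 2) := (contDiff_piLp_apply (p := 2) (𝕜 := ℝ) (E := fun _ : Fin 3 => ℝ) (i := (2 : Fin 3))).comp hslice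
  have hθd : Differentiable ℝ (fun x => v (-1) x 2) := hθ2.differentiable (by norm_num)
  have hDθd : Differentiable ℝ (fderiv ℝ fun x => v (-1) x 2) := (hθ2.fderiv_right (m := 1) le_rfl).differentiable (by simp)
  have hDg1 : fderiv ℝ g = fun x => σ • fderiv ℝ (fun x => v (-1) x 2) x := by
    funext x; rw [hg]; exact fderiv_const_mul (hθd x) σ
  have hDg : ∀ u w', fderiv ℝ (fderiv ℝ g) y u w' = σ * fderiv ℝ (fderiv ℝ (fun x => v (-1) x 2)) y u w' := by
    intro u w'
    rw [hDg1, fderiv_fun_const_smul (hDθd y)]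
    simp [smul_eq_mul]
  have hσ0 : σ ≠ 0 := by rcases hσ with h | h <;> simp [h]
  have hνg : fderiv ℝ (fderiv ℝ g) y ν ν = 0 := by rw [hDg, hν, mul_zero]
  have h := hessian_row_eq_zero_of_isMaxOn hg2 hmax hνg w
  rw [hDg] at h
  exact (mul_eq_zero.1 h).resolve_left hσ0

/-! ## Appended (port-2 g6): at a DEGENERATE hot point the whole Hessian vanishes -/

/-- **A negative semi-definite symmetric form on `ℝ³` with vanishing diagonal (horizontal trace `0` and vertical entry `0`) is zero.**  `B` symmetric, `B(w,w) ≤ 0` for all `w`,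
`B(e₀,e₀) + B(e₁,e₁) = 0`, `B(e₂,e₂) = 0` ⇒ `B(u,w) = 0` for all `u, w`. [folklore] -/
theorem bilin_eq_zero_of_nonpos_of_traces (B : EuclideanSpace ℝ (Fin 3) →L[ℝ] EuclideanSpace ℝ (Fin 3) →L[ℝ] ℝ)
    (hsymm : ∀ u w, B u w = B w u) (hnonpos : ∀ w, B w w ≤ 0)
    (hh : B (EuclideanSpace.single 0 1) (EuclideanSpace.single 0 1) + B (EuclideanSpace.single 1 1) (EuclideanSpace.single 1 1) = 0)
    (hz : B (EuclideanSpace.single 2 1) (EuclideanSpace.single 2 1) = 0) (u w : EuclideanSpace ℝ (Fin 3)) : B u w = 0 := by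
  have h00 : B (EuclideanSpace.single 0 1) (EuclideanSpace.single 0 1) = 0 := by
    have a := hnonpos (EuclideanSpace.single 0 1); have b := hnonpos (EuclideanSpace.single 1 1); linarith
  have h11 : B (EuclideanSpace.single 1 1) (EuclideanSpace.single 1 1) = 0 := by
    have a := hnonpos (EuclideanSpace.single 0 1); linarith
  have hrow : ∀ i : Fin 3, ∀ w', B (EuclideanSpace.single i 1) w' = 0 := by
    intro i w'
    fin_cases i
    · exact apply_eq_zero_of_nonpos_of_apply_self_eq_zero B hsymm hnonpos h00 w'
    · exact apply_eq_zero_of_nonpos_of_apply_self_eq_zero B hsymm hnonpos h11 w'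
    · exact apply_eq_zero_of_nonpos_of_apply_self_eq_zero B hsymm hnonpos hz w'
  have e : u = u 0 • EuclideanSpace.single 0 (1 : ℝ) + u 1 • EuclideanSpace.single 1 (1 : ℝ) + u 2 • EuclideanSpace.single 2 (1 : ℝ) := by
    ext i; fin_cases i <;> simp
  rw [e, map_add, map_add, map_smul, map_smul, map_smul]
  simp only [add_apply, smul_apply, smul_eq_mul, hrow 0 w, hrow 1 w, hrow 2 w, mul_zero, add_zero]

/-- **AT A DEGENERATE HOT POINT THE WHOLE HESSIAN OF `v₂(−1,·)` VANISHES** (memo T2B-g14 §13c: «κ = 0 ⇒ α = 0, β = μ₀κ = 0: the whole second jet of θ − N vanishes»).  Pinned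
class profile, hot point `y` (`v₂(−1,y) = N ≠ 0`) which is DEGENERATE — horizontal trace `∂₀²v₂ + ∂₁²v₂ = 0` at `y` — and vertically flat, `∂₂²v₂(y) = 0` (on a (TH) plane
this is the plane wave identity `∂₂²v₂ = −μΔₕv₂`); then `D²(v₂(−1,·))(y) = 0`. -/
theorem hessian_eq_zero_of_degenerate_hotPoint (hrate : HasTypeITimeDecay C v) (hcont : ContinuousOn (uncurry v) (Iio (0 : ℝ) ×ˢ univ))
    (hmild : ∀ s t : ℝ, s < t → t < 0 → ∀ x, v t x = UnboundedOperators.heatExtension (v s) (t - s) x - oseenDuhamel 1 s v v t x)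
    (hdiv : ∀ t < 0, VectorCalculus.IsDivFree (v t))
    (hne : v (-1) 0 2 ≠ 0) (hhot : ∀ t < 0, ∀ x, Real.sqrt (-t) * |v t x 2| ≤ |v (-1) 0 2|)
    {y : EuclideanSpace ℝ (Fin 3)} (hy : v (-1) y 2 = v (-1) 0 2)
    (hh : fderiv ℝ (fderiv ℝ (fun x => v (-1) x 2)) y (EuclideanSpace.single 0 1) (EuclideanSpace.single 0 1) +
      fderiv ℝ (fderiv ℝ (fun x => v (-1) x 2)) y (EuclideanSpace.single 1 1) (EuclideanSpace.single 1 1) = 0)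
    (hz : fderiv ℝ (fderiv ℝ (fun x => v (-1) x 2)) y (EuclideanSpace.single 2 1) (EuclideanSpace.single 2 1) = 0)
    (u w : EuclideanSpace ℝ (Fin 3)) : fderiv ℝ (fderiv ℝ (fun x => v (-1) x 2)) y u w = 0 := by
  have hneg : (-1 : ℝ) < 0 := by norm_num
  obtain ⟨σ, hσ, hσa⟩ : ∃ σ : ℝ, (σ = 1 ∨ σ = -1) ∧ σ * v (-1) 0 2 = |v (-1) 0 2| := by
    rcases lt_or_gt_of_ne hne with h | h
    · exact ⟨-1, Or.inr rfl, by rw [abs_of_neg h]; ring⟩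
    · exact ⟨1, Or.inl rfl, by rw [abs_of_pos h]; ring⟩
  have hσ1 : |σ| = 1 := by rcases hσ with h | h <;> simp [h]
  have hσ0 : σ ≠ 0 := by rcases hσ with h | h <;> simp [h]
  set g : EuclideanSpace ℝ (Fin 3) → ℝ := fun x => σ * v (-1) x 2 with hg
  have hg2 : ContDiff ℝ 2 g := contDiff_signed_slice hrate hcont hmild hdiv hneg σ
  have hmax : IsMaxOn g univ y := by
    intro x _
    have hx := hhot (-1) hneg x
    rw [neg_neg, Real.sqrt_one, one_mul] at hx
    show σ * v (-1) x 2 ≤ σ * v (-1) y 2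
    calc σ * v (-1) x 2 ≤ |σ * v (-1) x 2| := le_abs_self _
      _ = |v (-1) x 2| := by rw [abs_mul, hσ1, one_mul]
      _ ≤ |v (-1) 0 2| := hx
      _ = σ * v (-1) y 2 := by rw [hy, hσa]
  have hslice : ContDiff ℝ 2 (v (-1)) := contDiff_slice_of_class hrate hcont hmild hdiv hneg
  have hθ2 : ContDiff ℝ 2 (fun x => v (-1) x 2) := (contDiff_piLp_apply (p := 2) (𝕜 := ℝ) (E := fun _ : Fin 3 => ℝ) (i := (2 : Fin 3))).comp hslice
  have hθd : Differentiable ℝ (fun x => v (-1) x 2) := hθ2.differentiable (by norm_num)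
  have hDθd : Differentiable ℝ (fderiv ℝ fun x => v (-1) x 2) := (hθ2.fderiv_right (m := 1) le_rfl).differentiable (by simp)
  have hDg1 : fderiv ℝ g = fun x => σ • fderiv ℝ (fun x => v (-1) x 2) x := by
    funext x; rw [hg]; exact fderiv_const_mul (hθd x) σ
  have hDg : ∀ u' w', fderiv ℝ (fderiv ℝ g) y u' w' = σ * fderiv ℝ (fderiv ℝ (fun x => v (-1) x 2)) y u' w' := by
    intro u' w'
    rw [hDg1, fderiv_fun_const_smul (hDθd y)]
    simp [smul_eq_mul]
  have hs : IsSymmSndFDerivAt ℝ g y := (hg2.contDiffAt (x := y)).isSymmSndFDerivAt (by simp only [minSmoothness_of_isRCLikeNormedField]; norm_num)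
  have hhg : fderiv ℝ (fderiv ℝ g) y (EuclideanSpace.single 0 1) (EuclideanSpace.single 0 1) +
      fderiv ℝ (fderiv ℝ g) y (EuclideanSpace.single 1 1) (EuclideanSpace.single 1 1) = 0 := by
    rw [hDg, hDg, ← mul_add, hh, mul_zero]
  have hzg : fderiv ℝ (fderiv ℝ g) y (EuclideanSpace.single 2 1) (EuclideanSpace.single 2 1) = 0 := by rw [hDg, hz, mul_zero]
  have h := bilin_eq_zero_of_nonpos_of_traces (fderiv ℝ (fderiv ℝ g) y) (fun u w => hs u w) (hessian_nonpos_of_isMaxOn hg2 hmax) hhg hzg u w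
  rw [hDg] at h
  exact (mul_eq_zero.1 h).resolve_left hσ0

end Summit.NavierStokesRegularity.NavierStokesRegularity.Theorems.PoloidalWindowDoorLrcModEntireRidgeFlatHotPoint

end
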